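import Summits.BirchSwinnertonDyer.BirchSwinnertonDyer.Theorems.EisensteinPrimesCharLocalInertiaFrobenius
import Summits.BirchSwinnertonDyer.BirchSwinnertonDyer.Theorems.EisensteinPrimesUnrSelmerQuotientCorankLeGeneric
import Summits.BirchSwinnertonDyer.BirchSwinnertonDyer.Theorems.EisensteinPrimesNumPlacesAboveRepresentatives
import Literature.NumberTheory.EllipticCurves.ModularityVersionApProofs
import HarnessLib

/-!
# `corank_{ℤ_p}(H¹_{𝓕_nr^{Sf}}/H¹_{𝓕_nr}) ≤ Σ_{w∈Sf} λ(𝒫_w(θ))` for Keller–Yin's character modules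
# over the anticyclotomic tower — the UNCONDITIONAL `≤`-half of the bare `S`-relaxation corank
# identity `prop125_residualPair_unrSelmer_corank`, IN THE KERNEL (no named fact, no hypothesis
# beyond the binders)

Cell `bsd-eis` (home `run/shared/lean/pub/bsd-eis/`), seat `bsd-line-x1-p1-w2` (D-0154 width seat on
crux 2 `GoodLatticeBDPValue` = stmt-BirchSwinnertonDyer-19032, line `halves` v14, registered stub
`stub_imprimCorank : prop125_residualPair_unrSelmer_corank ∧ rem142_goodLattice_selmerAc_imprimitive`,
character conjunct). The typed input `KellerYin2024.prop125_residualPair_unrSelmer_corank` (KY / CGLS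
Prop. 1.2.5 as the BARE corank identity: Pollack–Weston A.2 surjectivity + the local `λ`-values of
Lemma 1.1.1) asserts `zpCorank (H¹_{𝓕_nr^{Sf}}/H¹_{𝓕_nr}) = Σ_{w∈Sf} charLocalLambda ∅ κ θ w`. This file
proves its `≤` half OUTRIGHT, assembling the seat's four helper files:

  `S^{Sf}/S^∅ ↪ ∏_{w∈Sf} ∏_{n < [Γ:Γ_w]} (r_w ∘ conj_{γⁿ})(S^{Sf})`
  (`UnrSelmerQuotientCorankLeGeneric.zpCorank_quotient_le_sum`, p606873, generic-M port of b2b X2),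
  `[Γ : Γ_w] = numPlacesAbove κ w` translates of the chosen place exhaust the places of `K_∞` above a
  finitely decomposed `w` (`NumPlacesAboveRepresentatives.forall_exists_lt_numPlacesAbove`, p607080),
  each factor has `zpCorank ≤ 𝟙[FrobActsAsNormAt ∅ θ w]`
  (`CharLocalInertiaFrobenius.zpCorank_le_ite_of_forall_exists`: `#H¹(I_w, M)[p] ≤ p`; no `p`-torsion
  for `θ` ramified at `w`; no `p`-torsion in the image for `θ` unramified with `θ(Frob_w) ≢ Nw`),
  and `numPlacesAbove κ w · 𝟙[…] = charLocalLambda ∅ κ θ w` by definition (KY Lemma 1.1.1's recipe).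

* `zpCorank_unrSelmer_quotient_le_sum_charLocalLambda` — for `K` imaginary quadratic, `2 < p`,
  (Heeg) for `N`, `p ∤ N`, `κ` anticyclotomic with topological generator `γ`, ANY `vbar`, ANY
  character `θ : Γ_K → GL₁(ℤ_p)` with `θ^{p−1} = 1`, `Sf` = the primes of `K` over `N`:
  `zpCorank (H¹_{𝓕_nr^{Sf}}/H¹_{𝓕_nr}) p ≤ Σ_{w∈Sf} charLocalLambda ∅ κ θ w`.
* `le_sum_charLocalLambda_at_residualPair` — the same under the VERBATIM binder block of
  `prop125_residualPair_unrSelmer_corank` (for `θ ∈ {θsub, θquot}` of the residual pair of the good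
  lattice), WITHOUT its [RH] cotorsion hypothesis — so the typed `=` is now "kernel `≤`" ∧ "PUB `≥`"
  (the `≥` is Pollack–Weston A.2 surjectivity = Poitou–Tate, which stays a named input).

HONEST FRAMING: theorems only (no definition, no named fact, no `sorry`); does NOT close the stub (the
`≥` half and the `f`-side conjunct `rem142_…` are untouched) — lands `--supports
stmt-BirchSwinnertonDyer-19032`; no summit statement, no BSD / Mazur main conjecture for any curve is
proved here.

References: Keller–Yin arXiv:2402.12781v2 Prop. 1.2.5 (TeX L780–800), Lemma 1.1.1 (L455–462), Lemma
1.0.1; Castella–Grossi–Lee–Skinner 2022 Prop. 1.2.5, Lemma 1.1.1; Greenberg–Vatsal 2000 §2 Cor. (2.3),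
Prop. (2.4); Pollack–Weston 2011 App. A Prop. A.2 (the untouched `≥`); Brink 2007 Thm. 2.
-/

-- `Summit.BirchSwinnertonDyer.BirchSwinnertonDyer.…`: summit and sub-problem share a name (D-0017 layout).
set_option linter.dupNamespace false
set_option autoImplicit false

noncomputable section

open scoped Classical AddSubgroup

open WeierstrassCurve NumberField IsDedekindDomain Field
  Literature.NumberTheory.EllipticCurves Literature.NumberTheory.EllipticCurves.ModularForms
  Literature.NumberTheory.QuadraticFields Literature.NumberTheory.EllipticCurves.Rank1Residual
  Literature.NumberTheory.EllipticCurves.Castella2018 Literature.NumberTheory.EllipticCurves.GreenbergSelmer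
  Literature.NumberTheory.EllipticCurves.GreenbergVatsal2000 Literature.NumberTheory.GaloisRepresentations
  Literature.NumberTheory.EllipticCurves.CastellaGrossiLeeSkinner2022
  Literature.NumberTheory.EllipticCurves.KellerYin2024
  Summit.BirchSwinnertonDyer.BirchSwinnertonDyer.Theorems

namespace Summit.BirchSwinnertonDyer.BirchSwinnertonDyer.Theorems.UnrSelmerQuotientCorankLeChar

variable {K : Type} [Field K] [NumberField K] {p : ℕ} [hp : Fact p.Prime]

omit [NumberField K] in
/-- A prime `w ∋ N` of `K` with `p ∤ N` does not contain `p` (Bezout: `1 = aN + bp ∈ w`). [folklore] -/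
theorem natCast_notMem_of_mem_of_not_dvd {N : ℕ} (hpN : ¬ p ∣ N) (w : HeightOneSpectrum (𝓞 K))
    (hw : ((N : ℤ) : 𝓞 K) ∈ w.asIdeal) : ((p : ℕ) : 𝓞 K) ∉ w.asIdeal := by
  intro hpw
  have hcop : IsCoprime (N : ℤ) (p : ℤ) :=
    Nat.isCoprime_iff_coprime.mpr (Nat.Coprime.symm ((Nat.Prime.coprime_iff_not_dvd hp.out).mpr hpN))
  obtain ⟨a, b, hab⟩ := hcop
  have hw' : ((N : ℕ) : 𝓞 K) ∈ w.asIdeal := by exact_mod_cast hw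
  have h1 : (1 : 𝓞 K) ∈ w.asIdeal := by
    have e := congrArg (fun z : ℤ ↦ (z : 𝓞 K)) hab
    push_cast at e
    rw [← e]
    exact w.asIdeal.add_mem (w.asIdeal.mul_mem_left _ hw') (w.asIdeal.mul_mem_left _ hpw)
  exact w.isPrime.ne_top ((Ideal.eq_top_iff_one _).mpr h1)

/-- **`zpCorank (H¹_{𝓕_nr^{Sf}}(K_∞,(F/𝒪)(θ)) / H¹_{𝓕_nr}(K_∞,(F/𝒪)(θ))) p ≤ Σ_{w∈Sf} λ(𝒫_w(θ))`,
UNCONDITIONALLY** — `K` imaginary quadratic, `2 < p`, (Heeg) for `N` with `p ∤ N`, `κ` anticyclotomic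
with topological generator `γ`, any `vbar`, any `θ : Γ_K → GL₁(ℤ_p)` with `θ^{p−1} = 1`, `Sf` = the
primes of `K` over `N` (all split over `ℚ`, `∤ p`, finitely decomposed in `K_∞` by Brink 2007). The
embedding `S^{Sf}/S ↪ ∏_{w} ∏_{n<[Γ:Γ_w]} Y_{w,n}` (generic, p606873) with the sharp count `[Γ : Γ_w] =
numPlacesAbove κ w` (p607080) and the per-place bound `zpCorank Y_{w,n} ≤ 𝟙[FrobActsAsNormAt ∅ θ w]`
(`CharLocalInertiaFrobenius.zpCorank_le_ite_of_forall_exists`); `numPlacesAbove κ w · 𝟙[…]` is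
`charLocalLambda ∅ κ θ w` by definition. The `≤` half of KY/CGLS Prop. 1.2.5's corank statement
("`λ(𝔛_θ^S) = λ(𝔛_θ) + Σ λ(𝒫_w(θ))`" via (eq:Gr to imp)) — the half that does NOT need Pollack–Weston
surjectivity. [cite: KellerYin2024, Prop. 1.2.5 and Lemma 1.1.1 (arXiv:2402.12781v2 TeX L780–800, L455–462)]
[cite: CastellaGrossiLeeSkinner2022, Prop. 1.2.5, Lemma 1.1.1] [cite: GreenbergVatsal2000, §2 Cor. (2.3), Prop. (2.4)]
[cite: Brink2007, Thm. 2] -/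
theorem zpCorank_unrSelmer_quotient_le_sum_charLocalLambda (hK : IsImaginaryQuadratic K) (hp2 : 2 < p)
    {N : ℕ} (hH : SatisfiesHeegnerHypothesis N K) (hpN : ¬ p ∣ N) (κ : ZpExtension K p)
    (hκ : κ.IsAnticyclotomic) {γ : absoluteGaloisGroup K} (hγ : κ.IsTopGenerator γ)
    (vbar : HeightOneSpectrum (𝓞 K))
    (θ : FramedGaloisRep K (padicCoeffIntegers (∅ : Set (PadicAlgCl p))) 1)
    (hθ : ∀ σ : absoluteGaloisGroup K, θ σ ^ (p - 1) = 1) (Sf : Finset (HeightOneSpectrum (𝓞 K)))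
    (hSf : ∀ w : HeightOneSpectrum (𝓞 K), w ∈ Sf ↔ ((N : ℤ) : 𝓞 K) ∈ w.asIdeal) :
    zpCorank (↥(unrSelmer κ (charModule (∅ : Set (PadicAlgCl p)) θ) vbar
        (↑Sf : Set (HeightOneSpectrum (𝓞 K)))) ⧸
      (unrSelmer κ (charModule (∅ : Set (PadicAlgCl p)) θ) vbar
          (∅ : Set (HeightOneSpectrum (𝓞 K)))).addSubgroupOf
        (unrSelmer κ (charModule (∅ : Set (PadicAlgCl p)) θ) vbar
          (↑Sf : Set (HeightOneSpectrum (𝓞 K))))) p ≤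
      ∑ w ∈ Sf, charLocalLambda (∅ : Set (PadicAlgCl p)) κ θ w := by
  set M := charModule (∅ : Set (PadicAlgCl p)) θ with hM
  haveI := IwasawaTwoVariable.finite_torsionBy_charModule (p := p) θ
  have hSfp : ∀ w ∈ Sf, ((p : ℕ) : 𝓞 K) ∉ w.asIdeal := fun w hw ↦
    natCast_notMem_of_mem_of_not_dvd hpN w ((hSf w).mp hw)
  have hD : ∀ w ∈ Sf, ∃ δ ∈ decomp (K := K) w, κ δ ≠ 1 := fun w hw ↦
    UnrSelmerQuotientTorsionFiniteChar.exists_mem_decomp_apply_ne_one_of_heegner hK hp2 hH κ hκ w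
      ((hSf w).mp hw) (hSfp w hw)
  have h := UnrSelmerQuotientCorankLeGeneric.zpCorank_quotient_le_sum κ (M := M)
    (GreenbergSelmer.exists_pow_smul_cofree_eq_zero (p := p) (∅ : Set (PadicAlgCl p)) θ)
    ⟨1, by rw [UnrSelmerQuotientTorsionFiniteChar.natCard_torsionBy_charModule, pow_one]⟩
    (UnrSelmerQuotientTorsionFiniteChar.exists_nsmul_eq_charModule θ)
    (GreenbergSelmer.isOpen_stabilizer_cofree (p := p) (∅ : Set (PadicAlgCl p)) θ)
    (AcSelmer.bdpData M p vbar) Sf hSfp (fun w ↦ numPlacesAbove κ w)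
    (fun w ↦ if FrobActsAsNormAt (∅ : Set (PadicAlgCl p)) θ w then 1 else 0)
    (fun w hw σ ↦ NumPlacesAboveRepresentatives.forall_exists_lt_numPlacesAbove κ w hγ (hD w hw) σ)
    (fun w hw Y hY ↦
      CharLocalInertiaFrobenius.zpCorank_le_ite_of_forall_exists θ w κ hθ (hSfp w hw) Y hY)
  exact h

/-- **The `≤` half of `prop125_residualPair_unrSelmer_corank`, under its VERBATIM binders** (the
`_`-prefixed ones are carried only to match the typed statement's block and are idle for the `≤`
direction; the [RH] cotorsion hypothesis of the typed statement is not needed either): for `E/ℚ`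
with a good anomalous Eisenstein prime `p > 2`, `K` imaginary quadratic with (Heeg) for `N_E`, `κ`
anticyclotomic, the residual pair `(θsub, θquot) = (ω̃, 𝟙̃)` and `θ ∈ {θsub, θquot}`:
`zpCorank (H¹_{𝓕_nr^{Sf}}/H¹_{𝓕_nr}) p ≤ Σ_{w∈Sf} charLocalLambda ∅ κ θ w`. With this, the character
conjunct of `stub_imprimCorank` is "PUB `≥` (Pollack–Weston A.2) ∧ kernel `≤`".
[cite: KellerYin2024, Prop. 1.2.5 (arXiv:2402.12781v2 TeX L780–800)] [cite: PollackWeston2011, App. A Prop. A.2]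
[cite: CastellaGrossiLeeSkinner2022, Prop. 1.2.5 and proof (eq:sur1)–(eq:sur2)] -/
theorem le_sum_charLocalLambda_at_residualPair
    (W : WeierstrassCurve ℚ) [W.IsElliptic] [W.IsGloballyMinimal] (p : ℕ) [Fact p.Prime]
    (hp : 2 < p) (hgood : Good W p) (_hred : Red W p) (_hanom : Anom W p)
    (_hlat : ∀ Φ : AddSubgroup (geomTorsion W (p : ℤ)), IsRationalLine W p Φ → ¬ LineUnramifiedAt W p Φ)
    (K : Type) [Field K] [NumberField K] (hK : IsImaginaryQuadratic K)
    (hH : SatisfiesHeegnerHypothesis (W.conductorNorm ℤ) K) (_hHp : SatisfiesHeegnerHypothesis p K)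
    (_htor : ∀ Q : (W.baseChange K).toAffine.Point, p • Q = 0 → Q = 0)
    (_ι : K →+* ℚ_[p]) (_v vbar : HeightOneSpectrum (𝓞 K))
    (κ : ZpExtension K p) (hκ : κ.IsAnticyclotomic)
    (γ : absoluteGaloisGroup K) [hγ : Fact (κ.IsTopGenerator γ)]
    (θsub θquot : FramedGaloisRep K (padicCoeffIntegers (∅ : Set (PadicAlgCl p))) 1)
    (hpair : IsResidualPairOver (W.baseChange K) p θsub θquot)
    (Sf : Finset (HeightOneSpectrum (𝓞 K)))
    (hSf : ∀ w : HeightOneSpectrum (𝓞 K), w ∈ Sf ↔ ((W.conductorNorm ℤ : ℤ) : 𝓞 K) ∈ w.asIdeal)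
    (θ : FramedGaloisRep K (padicCoeffIntegers (∅ : Set (PadicAlgCl p))) 1) (hθ : θ = θsub ∨ θ = θquot) :
    zpCorank (↥(unrSelmer κ (charModule (∅ : Set (PadicAlgCl p)) θ) vbar
        (↑Sf : Set (HeightOneSpectrum (𝓞 K)))) ⧸
      (unrSelmer κ (charModule (∅ : Set (PadicAlgCl p)) θ) vbar
          (∅ : Set (HeightOneSpectrum (𝓞 K)))).addSubgroupOf
        (unrSelmer κ (charModule (∅ : Set (PadicAlgCl p)) θ) vbar
          (↑Sf : Set (HeightOneSpectrum (𝓞 K))))) p ≤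
      ∑ w ∈ Sf, charLocalLambda (∅ : Set (PadicAlgCl p)) κ θ w := by
  have hpN : ¬ p ∣ W.conductorNorm ℤ := fun h ↦
    (W.dvd_conductorNorm_iff_not_hasGoodReductionAtPrime p).mp h hgood
  have hθpow : ∀ σ : absoluteGaloisGroup K, θ σ ^ (p - 1) = 1 := fun σ ↦ by
    rcases hθ with rfl | rfl
    · exact (hpair.pow_sub_one σ).1
    · exact (hpair.pow_sub_one σ).2
  exact zpCorank_unrSelmer_quotient_le_sum_charLocalLambda hK hp hH hpN κ hκ hγ.out vbar θ hθpow Sf hSf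

end Summit.BirchSwinnertonDyer.BirchSwinnertonDyer.Theorems.UnrSelmerQuotientCorankLeChar

end
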